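import Mathlib
import Summits.Ventures.PercRepro2.Defs
import Summits.Ventures.PercRepro2.Graph
import Summits.Ventures.PercRepro2.Induced
import Summits.Ventures.PercRepro2.VdBKahn
import Summits.Ventures.PercRepro2.ReimerVdBK
import Summits.Ventures.PercRepro2.ReimerVdBKRegions
import Summits.Ventures.PercRepro2.ReimerVdBKZClosed
import Summits.Ventures.PercRepro2.ReimerVdBKZReduction
import Summits.Ventures.PercRepro2.ReimerVdBKZSplit

/-!
# (R-1.2) by recursion on the conditioning set: the closed-neighbourhood theorem
(blind cell PercRepro2, mine-c g46; `conjectures/MINE-C.md` §55)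

`ReimerVdBKZSplit` gives the one-edge recursion step: (R-1.2) on `G` follows from (R-1.2) on `G` with one
edge `{z, y}` at a doubly-avoided vertex `z ∈ X ∩ Y` turned into a loop, for the sub-instances with `y` pinned
away from one world — PROVIDED `y` is marked (`y ∈ A ∪ B ∪ X ∪ Y`), is the root, or the edge is a loop.
Iterating: marks only grow, the purely-avoided set `W₀ = (X ∪ Y) ∖ (A ∪ B)` never changes, and a vertex
enters `X ∩ Y` only when it lies in `W₀` and is adjacent to the current doubly-avoided vertex.  So if `T` is a
set of vertices containing `X ∩ Y`, CLOSED under adjacency inside `W₀`, every non-loop edge of which leads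
to a marked vertex or the root, then every doubly-avoided vertex met along the recursion lies in `T` and has
only marked neighbours, and the recursion ends at instances in which every doubly-avoided vertex carries
only loops — a Harris pair (`rvdBK_of_disjoint`).  THEOREM `rvdBK_of_closed_marked`, by strong induction
on the number of non-loop edges.  Corollaries: `rvdBK_of_allMarked` (every vertex other than the root is
in `A ∪ B ∪ X ∪ Y`) and the surrounded case `rvdBK_of_nbrsMarked'` of g45 (`T = {z}`).
-/

namespace Summit.Ventures.PercRepro2
namespace ReimerVdBK
open Classical

variable {V : Type*} {E : Type*} [Fintype E] [DecidableEq E] [Fintype V] [DecidableEq V]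
variable (ends : E → Sym2 V)

/-! ## The non-loop edges -/

/-- The non-loop edges of the graph. -/
def nonloop : Finset E := Finset.univ.filter (fun e => ¬ (ends e).IsDiag)

omit [DecidableEq E] [Fintype V] in
/-- Membership in `nonloop`. -/
lemma mem_nonloop {e : E} : e ∈ nonloop ends ↔ ¬ (ends e).IsDiag := by
  simp [nonloop]

omit [Fintype V] in
/-- Turning a non-loop edge into a loop removes it from `nonloop`. -/
lemma nonloop_loopAt {e : E} (hne : ¬ (ends e).IsDiag) (z : V) :
    nonloop (loopAt ends e z) = (nonloop ends).erase e := by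
  ext f
  simp only [mem_nonloop, Finset.mem_erase]
  by_cases hfe : f = e
  · subst hfe
    simp [loopAt_apply_self, Sym2.mk_isDiag_iff]
  · rw [loopAt_apply_of_ne ends hfe]
    simp [hfe]

omit [Fintype V] in
/-- Turning a non-loop edge into a loop lowers the number of non-loop edges. -/
lemma card_nonloop_loopAt_lt {e : E} (hne : ¬ (ends e).IsDiag) (z : V) :
    (nonloop (loopAt ends e z)).card < (nonloop ends).card := by
  rw [nonloop_loopAt ends hne z]
  exact Finset.card_erase_lt_of_mem ((mem_nonloop ends).2 hne)

variable (s : V)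

/-! ## Inert vertices: only loops -/

omit [Fintype E] [DecidableEq E] [Fintype V] [DecidableEq V] in
/-- A vertex `z ≠ s` carrying only loops is never reached. -/
lemma not_conn_of_loops_only {z : V} (hz : ∀ e, z ∈ ends e → (ends e).IsDiag) (hsz : s ≠ z)
    (ω : Config E) : ¬ Conn ends ω s z := by
  intro h
  let S : Set V := {x | x ≠ z}
  have hS : ∀ x ∈ S, ∀ y, (openGraph ends ω).Adj x y → y ∈ S := by
    intro x hx y hxy hyz
    obtain ⟨hne, e, _, hends⟩ := openGraph_adj.1 hxy
    have hze : z ∈ ends e := by rw [hends, ← hyz]; exact Sym2.mem_mk_right x y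
    have := hz e hze
    rw [hends, Sym2.mk_isDiag_iff] at this
    exact hne this
  exact mem_of_conn_of_closed hS hsz h rfl

omit [Fintype V] in
/-- Inert vertices (only loops, not the root) can be dropped from the avoided sets. -/
lemma reimerCount_sdiff_of_inert (T : Finset V)
    (hT : ∀ z ∈ T, s ≠ z ∧ ∀ e, z ∈ ends e → (ends e).IsDiag) (A X B Y : Finset V) :
    reimerCount ends s A X B Y = reimerCount ends s A (X \ T) B (Y \ T) := by
  unfold reimerCount
  congr 1
  ext ω
  simp only [twoWorld, connAll, avoidAll, Set.mem_inter_iff, Set.mem_setOf_eq, mem_bar,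
    Finset.mem_sdiff]
  constructor
  · rintro ⟨⟨ha, hx⟩, hb, hy⟩
    exact ⟨⟨ha, fun x hx' => hx x hx'.1⟩, hb, fun y hy' => hy y hy'.1⟩
  · rintro ⟨⟨ha, hx⟩, hb, hy⟩
    refine ⟨⟨ha, fun x hx' => ?_⟩, hb, fun y hy' => ?_⟩
    · by_cases hxT : x ∈ T
      · exact not_conn_of_loops_only ends s (hT x hxT).2 (hT x hxT).1 ω
      · exact hx x ⟨hx', hxT⟩
    · by_cases hyT : y ∈ T
      · exact not_conn_of_loops_only ends s (hT y hyT).2 (hT y hyT).1 (compl ω)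
      · exact hy y ⟨hy', hyT⟩

omit [Fintype V] in
/-- **The base case**: if every doubly-avoided vertex carries only loops and is not the root, the instance
is a Harris pair up to inert vertices, and (R-1.2) holds. -/
theorem rvdBK_of_inert {A X B Y : Finset V}
    (hT : ∀ z ∈ X ∩ Y, s ≠ z ∧ ∀ e, z ∈ ends e → (ends e).IsDiag) : RvdBK ends s A X B Y := by
  unfold RvdBK
  rw [reimerCount_sdiff_of_inert ends s (X ∩ Y) hT A X B Y,
    reimerCount_sdiff_of_inert ends s (X ∩ Y) hT (A ∪ B) (X ∩ Y) ∅ (X ∪ Y), Finset.sdiff_self,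
    Finset.union_sdiff_distrib]
  have hdisj : (X \ (X ∩ Y)) ∩ (Y \ (X ∩ Y)) = ∅ := by
    ext v
    simp only [Finset.mem_inter, Finset.mem_sdiff, Finset.notMem_empty, iff_false]
    rintro ⟨⟨hvX, hv⟩, hvY, _⟩
    exact hv ⟨hvX, hvY⟩
  have h := rvdBK_of_disjoint ends s A (X \ (X ∩ Y)) B (Y \ (X ∩ Y)) hdisj
  unfold RvdBK at h
  rw [hdisj] at h
  exact h

/-! ## The theorem -/

/-- **(R-1.2) by recursion on the conditioning set.**  Let `A ∩ X = B ∩ Y = ∅` and let `T` be a set of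
vertices with `X ∩ Y ⊆ T` such that (i) every non-loop edge at a vertex of `T` leads to the root or to a marked
vertex (`A ∪ B ∪ X ∪ Y`), and (ii) `T` is closed under adjacency into the purely-avoided set
`(X ∪ Y) ∖ (A ∪ B)`.  Then `Φ(A, X; B, Y) ≤ Φ(A ∪ B, X ∩ Y; ∅, X ∪ Y)`. -/
theorem rvdBK_of_closed_marked (T : Finset V) {A X B Y : Finset V} (hAX : Disjoint A X)
    (hBY : Disjoint B Y) (hZT : X ∩ Y ⊆ T)
    (hTm : ∀ e z y, ends e = s(z, y) → z ∈ T → y ≠ z → y = s ∨ y ∈ A ∪ B ∪ X ∪ Y)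
    (hTc : ∀ e z y, ends e = s(z, y) → z ∈ T → y ∈ (X ∪ Y) \ (A ∪ B) → y ∈ T) :
    RvdBK ends s A X B Y := by
  suffices H : ∀ N : ℕ, ∀ (ends : E → Sym2 V) (A X B Y : Finset V), (nonloop ends).card = N →
      Disjoint A X → Disjoint B Y → X ∩ Y ⊆ T →
      (∀ e z y, ends e = s(z, y) → z ∈ T → y ≠ z → y = s ∨ y ∈ A ∪ B ∪ X ∪ Y) →
      (∀ e z y, ends e = s(z, y) → z ∈ T → y ∈ (X ∪ Y) \ (A ∪ B) → y ∈ T) →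
      RvdBK ends s A X B Y from H _ ends A X B Y rfl hAX hBY hZT hTm hTc
  intro N
  induction N using Nat.strong_induction_on with
  | _ N ih =>
  intro ends A X B Y hN hAX hBY hZT hTm hTc
  -- the root doubly avoided: the left side vanishes
  by_cases hsZ : s ∈ X ∩ Y
  · unfold RvdBK
    rw [reimerCount_eq_zero_of_root_mem_X ends s A (Finset.mem_inter.1 hsZ).1 B Y]
    exact Nat.zero_le _
  by_cases hact : ∃ e z y, ends e = s(z, y) ∧ z ∈ X ∩ Y ∧ y ≠ z
  · -- an active edge at a doubly-avoided vertex: split it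
    obtain ⟨e, z, y, hends, hzZ, hyz⟩ := hact
    obtain ⟨hzX, hzY⟩ := Finset.mem_inter.1 hzZ
    have hsz : s ≠ z := fun h => hsZ (by rw [h]; exact hzZ)
    have hzT : z ∈ T := hZT hzZ
    have hne : ¬ (ends e).IsDiag := by
      rw [hends, Sym2.mk_isDiag_iff]; exact fun h => hyz h.symm
    have hcard : (nonloop (loopAt ends e z)).card < N := by
      rw [← hN]; exact card_nonloop_loopAt_lt ends hne z
    have hy : y = s ∨ y = z ∨ y ∈ A ∨ y ∈ B ∨ y ∈ X ∨ y ∈ Y := by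
      rcases hTm e z y hends hzT hyz with h | h
      · exact Or.inl h
      · simp only [Finset.mem_union] at h
        rcases h with ((h | h) | h) | h
        · exact Or.inr (Or.inr (Or.inl h))
        · exact Or.inr (Or.inr (Or.inr (Or.inl h)))
        · exact Or.inr (Or.inr (Or.inr (Or.inr (Or.inl h))))
        · exact Or.inr (Or.inr (Or.inr (Or.inr (Or.inr h))))
    -- the looped graph keeps the hypotheses on `T`
    have hfe_of : ∀ f z' y', loopAt ends e z f = s(z', y') → y' ≠ z' → f ≠ e := by
      intro f z' y' hf hy'z' hfe
      rw [hfe, loopAt_apply_self, Sym2.eq_iff] at hf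
      rcases hf with ⟨h1, h2⟩ | ⟨h1, h2⟩
      · exact hy'z' (h2.symm.trans h1)
      · exact hy'z' (h1.symm.trans h2)
    have hTm' : ∀ f z' y', loopAt ends e z f = s(z', y') → z' ∈ T → y' ≠ z' →
        y' = s ∨ y' ∈ A ∪ B ∪ X ∪ Y := by
      intro f z' y' hf hz'T hy'z'
      have hfe := hfe_of f z' y' hf hy'z'
      rw [loopAt_apply_of_ne ends hfe] at hf
      exact hTm f z' y' hf hz'T hy'z'
    have hsub1 : A ∪ B ∪ X ∪ Y ⊆ A ∪ B ∪ insert y X ∪ Y :=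
      Finset.union_subset_union (Finset.union_subset_union (Finset.Subset.refl _)
        (Finset.subset_insert y X)) (Finset.Subset.refl _)
    have hsub2 : A ∪ B ∪ X ∪ Y ⊆ A ∪ B ∪ X ∪ insert y Y :=
      Finset.union_subset_union (Finset.Subset.refl _) (Finset.subset_insert y Y)
    -- the vertex `y` lies in `T` as soon as it is purely avoided
    have hyT : y ≠ s → y ∉ A → y ∉ B → y ∈ T := by
      intro hys hyA hyB
      rcases hTm e z y hends hzT hyz with h | h
      · exact absurd h hys
      · refine hTc e z y hends hzT ?_
        simp only [Finset.mem_sdiff, Finset.mem_union] at h ⊢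
        refine ⟨?_, fun h' => h'.elim hyA hyB⟩
        rcases h with ((h | h) | h) | h
        · exact absurd h hyA
        · exact absurd h hyB
        · exact Or.inl h
        · exact Or.inr h
    refine rvdBK_split ends s hends hsz hzX hzY hAX hBY hy ?_ ?_
    · -- the sub-instance `(A, X ∪ {y}; B, Y)`
      intro hys hyA
      refine ih _ hcard (loopAt ends e z) A (insert y X) B Y rfl
        (Finset.disjoint_insert_right.2 ⟨hyA, hAX⟩) hBY ?_ ?_ ?_
      · intro v hv
        rw [Finset.mem_inter, Finset.mem_insert] at hv
        rcases hv with ⟨hv1 | hv1, hv2⟩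
        · rw [hv1] at hv2 ⊢
          exact hyT hys hyA (fun h => Finset.disjoint_left.1 hBY h hv2)
        · exact hZT (Finset.mem_inter.2 ⟨hv1, hv2⟩)
      · intro f z' y' hf hz'T hy'z'
        rcases hTm' f z' y' hf hz'T hy'z' with h | h
        · exact Or.inl h
        · exact Or.inr (hsub1 h)
      · intro f z' y' hf hz'T hy'
        rw [Finset.mem_sdiff, Finset.mem_union, Finset.mem_insert] at hy'
        obtain ⟨hy'1, hy'2⟩ := hy'
        by_cases hfe : f = e
        · -- the looped edge: `y' = z ∈ T`
          rw [hfe, loopAt_apply_self, Sym2.eq_iff] at hf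
          have hy'z : y' = z := by
            rcases hf with ⟨_, h2⟩ | ⟨h1, _⟩
            · exact h2.symm
            · exact h1.symm
          rw [hy'z]; exact hzT
        · rw [loopAt_apply_of_ne ends hfe] at hf
          rcases hy'1 with (hy'y | hy'X) | hy'Y
          · rw [hy'y] at hy'2 ⊢
            exact hyT hys hyA (fun h => hy'2 (Finset.mem_union_right _ h))
          · exact hTc f z' y' hf hz'T
              (by rw [Finset.mem_sdiff, Finset.mem_union]; exact ⟨Or.inl hy'X, hy'2⟩)
          · exact hTc f z' y' hf hz'T
              (by rw [Finset.mem_sdiff, Finset.mem_union]; exact ⟨Or.inr hy'Y, hy'2⟩)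
    · -- the sub-instance `(A, X; B, Y ∪ {y})`
      intro hys hyB
      refine ih _ hcard (loopAt ends e z) A X B (insert y Y) rfl hAX
        (Finset.disjoint_insert_right.2 ⟨hyB, hBY⟩) ?_ ?_ ?_
      · intro v hv
        rw [Finset.mem_inter, Finset.mem_insert] at hv
        rcases hv with ⟨hv1, hv2 | hv2⟩
        · rw [hv2] at hv1 ⊢
          exact hyT hys (fun h => Finset.disjoint_left.1 hAX h hv1) hyB
        · exact hZT (Finset.mem_inter.2 ⟨hv1, hv2⟩)
      · intro f z' y' hf hz'T hy'z'
        rcases hTm' f z' y' hf hz'T hy'z' with h | h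
        · exact Or.inl h
        · exact Or.inr (hsub2 h)
      · intro f z' y' hf hz'T hy'
        rw [Finset.mem_sdiff, Finset.mem_union, Finset.mem_insert] at hy'
        obtain ⟨hy'1, hy'2⟩ := hy'
        by_cases hfe : f = e
        · rw [hfe, loopAt_apply_self, Sym2.eq_iff] at hf
          have hy'z : y' = z := by
            rcases hf with ⟨_, h2⟩ | ⟨h1, _⟩
            · exact h2.symm
            · exact h1.symm
          rw [hy'z]; exact hzT
        · rw [loopAt_apply_of_ne ends hfe] at hf
          rcases hy'1 with hy'X | (hy'y | hy'Y)
          · exact hTc f z' y' hf hz'T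
              (by rw [Finset.mem_sdiff, Finset.mem_union]; exact ⟨Or.inl hy'X, hy'2⟩)
          · rw [hy'y] at hy'2 ⊢
            exact hyT hys (fun h => hy'2 (Finset.mem_union_left _ h)) hyB
          · exact hTc f z' y' hf hz'T
              (by rw [Finset.mem_sdiff, Finset.mem_union]; exact ⟨Or.inr hy'Y, hy'2⟩)
  · -- no active edge: every doubly-avoided vertex carries only loops
    push Not at hact
    refine rvdBK_of_inert ends s fun z hz => ⟨fun h => hsZ (by rw [h]; exact hz), fun e he => ?_⟩
    obtain ⟨y, hy⟩ := Sym2.mem_iff_exists.1 he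
    rw [hy, Sym2.mk_isDiag_iff]
    exact (hact e z y hy hz).symm

/-! ## Corollaries -/

/-- **(R-1.2) for fully marked instances**: if every vertex other than the root lies in `A ∪ B ∪ X ∪ Y`
(and `A ∩ X = B ∩ Y = ∅`), then `Φ(A, X; B, Y) ≤ Φ(A ∪ B, X ∩ Y; ∅, X ∪ Y)`. -/
theorem rvdBK_of_allMarked {A X B Y : Finset V} (hAX : Disjoint A X) (hBY : Disjoint B Y)
    (hM : ∀ v, v ≠ s → v ∈ A ∪ B ∪ X ∪ Y) : RvdBK ends s A X B Y :=
  rvdBK_of_closed_marked ends s Finset.univ hAX hBY (Finset.subset_univ _)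
    (fun _ _ y _ _ _ => by
      by_cases h : y = s
      · exact Or.inl h
      · exact Or.inr (hM y h))
    (fun _ _ _ _ _ _ => Finset.mem_univ _)

/-- `rvdBK_of_allMarked` without the disjointness hypotheses (a vertex of `A ∩ X` or `B ∩ Y` empties the
left side). -/
theorem rvdBK_of_allMarked' {A X B Y : Finset V} (hM : ∀ v, v ≠ s → v ∈ A ∪ B ∪ X ∪ Y) :
    RvdBK ends s A X B Y := by
  by_cases hAX : Disjoint A X
  · by_cases hBY : Disjoint B Y
    · exact rvdBK_of_allMarked ends s hAX hBY hM
    · unfold RvdBK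
      rw [reimerCount_eq_zero_of_not_disjoint_right ends s A X hBY]
      exact Nat.zero_le _
  · unfold RvdBK
    rw [reimerCount_eq_zero_of_not_disjoint_left ends s hAX B Y]
    exact Nat.zero_le _

/-- The surrounded case of g45 (`rvdBK_of_nbrsMarked`) as the instance `T = {z}` of the theorem: if
`X ∩ Y = ∅`, `z ≠ s` is unmarked and every edge at `z` leads to a vertex `y ≠ z` of `A ∪ B`, then
`Φ(A, X ∪ {z}; B, Y ∪ {z}) ≤ Φ(A ∪ B, {z}; ∅, X ∪ Y ∪ {z})`. -/
theorem rvdBK_of_nbrsMarked' {z : V} {A X B Y : Finset V} (hz : z ∉ A ∪ X ∪ B ∪ Y) (_hsz : s ≠ z)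
    (hXY : X ∩ Y = ∅) (hn : ∀ e y, ends e = s(z, y) → y ≠ z ∧ (y ∈ A ∨ y ∈ B)) :
    RvdBK ends s A (insert z X) B (insert z Y) := by
  have hzA : z ∉ A := fun h => hz (by simp [h])
  have hzX : z ∉ X := fun h => hz (by simp [h])
  have hzB : z ∉ B := fun h => hz (by simp [h])
  have hzY : z ∉ Y := fun h => hz (by simp [h])
  by_cases hAX : Disjoint A X
  · by_cases hBY : Disjoint B Y
    · refine rvdBK_of_closed_marked ends s {z} (Finset.disjoint_insert_right.2 ⟨hzA, hAX⟩)
        (Finset.disjoint_insert_right.2 ⟨hzB, hBY⟩) ?_ ?_ ?_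
      · intro v hv
        rw [Finset.mem_inter, Finset.mem_insert, Finset.mem_insert] at hv
        rw [Finset.mem_singleton]
        rcases hv with ⟨hv1 | hv1, hv2 | hv2⟩
        · exact hv1
        · exact hv1
        · exact hv2
        · exact absurd (Finset.mem_inter.2 ⟨hv1, hv2⟩) (by rw [hXY]; exact Finset.notMem_empty v)
      · intro e z' y hends hz'T _
        rw [Finset.mem_singleton] at hz'T
        rw [hz'T] at hends
        right
        rcases (hn e y hends).2 with h | h
        · simp [h]
        · simp [h]
      · intro e z' y hends hz'T hy
        rw [Finset.mem_singleton] at hz'T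
        rw [hz'T] at hends
        rw [Finset.mem_sdiff, Finset.mem_union] at hy
        exact absurd ((hn e y hends).2.elim (fun h => Finset.mem_union_left _ h)
          (fun h => Finset.mem_union_right _ h)) hy.2
    · unfold RvdBK
      rw [reimerCount_eq_zero_of_not_disjoint_right ends s A (insert z X)
        (fun h => hBY (Finset.disjoint_insert_right.1 h).2)]
      exact Nat.zero_le _
  · unfold RvdBK
    rw [reimerCount_eq_zero_of_not_disjoint_left ends s
      (fun h => hAX (Finset.disjoint_insert_right.1 h).2) B (insert z Y)]
    exact Nat.zero_le _

end ReimerVdBK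
end Summit.Ventures.PercRepro2
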